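import Summits.Ventures.Crystal3D.Theorems.StickyWulffConstantCoaxialWallLawBiPlanarRowMid
import HarnessLib

/-!
# The (F-γ) bi-planar rung near the half-layer offset, in the SHAPE OF THE STUB (`∃` frame, constant `½`, `R₀ = 10`)

HONEST FRAMING. Part of the venture `Summits/Ventures/Crystal3D` (cell `crystal3d-full`), helper
`--supports` the crux `CoaxialWallLaw` (stmt-Ventures-19481, `route-Ventures-StickyWulffConstant`),
REGISTERED line `WallLedgerF`, open stub `stub_coaxialTwoSlabAdhesion`.  RUNG CREDIT ONLY; F-C1 not moved.

`coaxialTwoSlabAdhesion_biPlanar_mid_stub`: for a pair of moved fcc lattices that is co-axial in a frame in which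
grain 2's basal planes sit within `0.155` layer spacings of HALF-WAY between grain 1's
(`(L⁻¹(s₂ − s₁))₂ = (n + τ)·√(2/3)`, `τ ∈ [0.345, 0.655]`; the class around lit's rigid optimum `T*`, `τ = ½`), the
conclusion of `WallLedgerF.CoaxialTwoSlabAdhesion` holds VERBATIM (that frame, `R₀ = 10`, constant `½`) for every
filling with every ball on a basal plane of grain 1 or of grain 2 (in-plane positions free) — the explicit-frame rung
`coaxialTwoSlabAdhesion_biPlanar_mid` (`…BiPlanarRowMid`, constant `√6/4`, KERNEL GRADE) weakened to `½`.
(`Λ₁ ≠ Λ₂` is automatic: the grains are disjoint.)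

WHAT THIS IS NOT: the stub (arbitrary fillings, arbitrary co-axial pairs); F-C1 not moved.
-/

noncomputable section

namespace Summit.Ventures.Crystal3D.Theorems

open Summit.Ventures.Crystal3D Finset
open Literature.MathematicalPhysics.StatisticalMechanics (fccStacking barlowStacking IsHaggSeq
  contactDeficiency)
open scoped InnerProductSpace

open scoped Classical in
/-- **The (F-γ) bi-planar rung near the half-layer offset, stub-shaped.**  See the module docstring. -/
theorem coaxialTwoSlabAdhesion_biPlanar_mid_stub
    (A₁ : EuclideanSpace ℝ (Fin 3) ≃ₗᵢ[ℝ] EuclideanSpace ℝ (Fin 3)) (t₁ : EuclideanSpace ℝ (Fin 3))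
    (A₂ : EuclideanSpace ℝ (Fin 3) ≃ₗᵢ[ℝ] EuclideanSpace ℝ (Fin 3)) (t₂ : EuclideanSpace ℝ (Fin 3))
    (hhalf : ∃ (L : EuclideanSpace ℝ (Fin 3) ≃ₗᵢ[ℝ] EuclideanSpace ℝ (Fin 3))
        (s₁ s₂ : EuclideanSpace ℝ (Fin 3)) (σ σ' : ℤ → ℤ), IsHaggSeq σ ∧ IsHaggSeq σ' ∧
        (fun p => A₁ p + t₁) '' fccStacking 1 (Real.sqrt (2 / 3)) ⊆
          (fun p => L p + s₁) '' barlowStacking 1 (Real.sqrt (2 / 3)) σ ∧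
        (fun p => A₂ p + t₂) '' fccStacking 1 (Real.sqrt (2 / 3)) ⊆
          (fun p => L p + s₂) '' barlowStacking 1 (Real.sqrt (2 / 3)) σ' ∧
        ∃ (n : ℤ) (τ : ℝ), 0.345 ≤ τ ∧ τ ≤ 0.655 ∧ (L.symm (s₂ - s₁)) 2 = (n + τ) * Real.sqrt (2 / 3)) :
    ∃ (L : EuclideanSpace ℝ (Fin 3) ≃ₗᵢ[ℝ] EuclideanSpace ℝ (Fin 3))
        (s₁ s₂ : EuclideanSpace ℝ (Fin 3)) (σ σ' : ℤ → ℤ), IsHaggSeq σ ∧ IsHaggSeq σ' ∧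
        (fun p => A₁ p + t₁) '' fccStacking 1 (Real.sqrt (2 / 3)) ⊆
          (fun p => L p + s₁) '' barlowStacking 1 (Real.sqrt (2 / 3)) σ ∧
        (fun p => A₂ p + t₂) '' fccStacking 1 (Real.sqrt (2 / 3)) ⊆
          (fun p => L p + s₂) '' barlowStacking 1 (Real.sqrt (2 / 3)) σ' ∧
    ∃ C R₀ : ℝ, 1 ≤ R₀ ∧ ∀ h : ℝ, 0 ≤ h → ∀ ρ : ℝ, R₀ ≤ ρ →
      ∀ X P₁ P₂ : Finset (EuclideanSpace ℝ (Fin 3)),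
      (∀ p ∈ X, ∀ q ∈ X, p ≠ q → 1 ≤ dist p q) → P₁ ⊆ X → P₂ ⊆ X \ P₁ →
      (∀ p ∈ X, -(2 * R₀) ≤ p 2 ∧ p 2 ≤ h + 2 * R₀ ∧ p 0 ^ 2 + p 1 ^ 2 ≤ ρ ^ 2) →
      (∀ p, p ∈ P₁ ↔ (p ∈ (fun q => A₁ q + t₁) '' fccStacking 1 (Real.sqrt (2 / 3)) ∧
        -(2 * R₀) ≤ p 2 ∧ p 2 ≤ -R₀ ∧ p 0 ^ 2 + p 1 ^ 2 ≤ ρ ^ 2)) →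
      (∀ p, p ∈ P₂ ↔ (p ∈ (fun q => A₂ q + t₂) '' fccStacking 1 (Real.sqrt (2 / 3)) ∧
        h + R₀ ≤ p 2 ∧ p 2 ≤ h + 2 * R₀ ∧ p 0 ^ 2 + p 1 ^ 2 ≤ ρ ^ 2)) →
      (∀ p ∈ X, (∃ k : ℤ, (L.symm (p - s₁)) 2 = k * Real.sqrt (2 / 3)) ∨
        (∃ k : ℤ, (L.symm (p - s₂)) 2 = k * Real.sqrt (2 / 3))) →
      ((((P₁ ×ˢ (X \ P₁)).filter fun pq => dist pq.1 pq.2 = 1).card : ℕ) : ℝ) +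
        ((((P₂ ×ˢ ((X \ P₁) \ P₂)).filter fun pq => dist pq.1 pq.2 = 1).card : ℕ) : ℝ) ≤
        contactDeficiency ((X \ P₁) \ P₂) +
          (Real.sqrt 2 / 4 * ∑ᶠ w ∈ {w ∈ fccStacking 1 (Real.sqrt (2 / 3)) | ‖w‖ = 1},
              |⟪w, A₁.symm (EuclideanSpace.single (2 : Fin 3) (1 : ℝ))⟫_ℝ| +
            Real.sqrt 2 / 4 * ∑ᶠ w ∈ {w ∈ fccStacking 1 (Real.sqrt (2 / 3)) | ‖w‖ = 1},
              |⟪w, A₂.symm (EuclideanSpace.single (2 : Fin 3) (1 : ℝ))⟫_ℝ| -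
            (1 / 2 : ℝ) * Real.sqrt (1 - ⟪L (EuclideanSpace.single (2 : Fin 3) (1 : ℝ)),
              (EuclideanSpace.single (2 : Fin 3) (1 : ℝ))⟫_ℝ ^ 2)) * Real.pi * ρ ^ 2 +
          C * (1 + h) * ρ := by
  obtain ⟨L, s₁, s₂, σ, σ', hσ, hσ', hsub₁, hsub₂, n, τ, hτ0, hτ1, hoff⟩ := hhalf
  obtain ⟨C, hmain⟩ := coaxialTwoSlabAdhesion_biPlanar_mid A₁ t₁ A₂ t₂ L s₁ s₂ hσ hσ' hsub₁ hsub₂ hτ0 hτ1 hoff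
  refine ⟨L, s₁, s₂, σ, σ', hσ, hσ', hsub₁, hsub₂, C, 10, by norm_num, ?_⟩
  intro h hh ρ hρ X P₁ P₂ hX hP₁X hP₂X hcell hP₁ hP₂ hbi
  have hfin := hmain h hh ρ hρ X P₁ P₂ hX hP₁X hP₂X hcell hP₁ hP₂ hbi
  have hs0 : 0 ≤ Real.sqrt (1 - ⟪L (EuclideanSpace.single (2 : Fin 3) (1 : ℝ)),
      (EuclideanSpace.single (2 : Fin 3) (1 : ℝ))⟫_ℝ ^ 2) := Real.sqrt_nonneg _
  have h6 : (1 / 2 : ℝ) ≤ Real.sqrt 6 / 4 := by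
    have h4 : Real.sqrt 4 = 2 := by
      rw [show (4 : ℝ) = 2 ^ 2 by norm_num, Real.sqrt_sq (by norm_num)]
    have h46 : Real.sqrt 4 ≤ Real.sqrt 6 := Real.sqrt_le_sqrt (by norm_num)
    rw [h4] at h46
    linarith
  have hρ0 : (0 : ℝ) ≤ Real.pi * ρ ^ 2 := by positivity
  nlinarith [hfin, mul_le_mul_of_nonneg_right h6 (mul_nonneg hs0 hρ0)]

end Summit.Ventures.Crystal3D.Theorems

end
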